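/-
Copyright (c) 2026 the pub-hodgecm-mathlib formalisation cell (harness21).  Prover seat hodgecm-mathlib-K2E3-p26 (g2), Track B «K2-LIT» (valve hand → L1),
#184♮ = hLiu418 = `stmt-HodgeConjecture-24832`; socket #41, KIND 1, organ (K1b-W) «KIND W at `n := 1` for the pulled-back family» (line lead K2Liu-p14 (g4), FILE CUT
2026-09-04T22:32:01Z, LINE WORD #1 22:42:47Z (3) «=»), brick (KW1-c) sub-brick (c1) «LEVEL vs HEIGHT» (generic `N`).  THEOREMS ONLY (no `def`, no `instance`, no notation,
no named-fact hypothesis, no `sorry`); lane `--supports stmt-HodgeConjecture-24832` (count-neutral helper; closes no socket by itself).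
-/
import Summits.HodgeConjecture.HodgeConjecture.Theorems.K2E3CongruenceLayerIntertwiningGL   -- ★ (K2E3-p09 lineage): `conj_mem_congruenceGL_pow_of_height`, `inv_conj_mem_…` (an element of height `≤ h` conjugates `K_{m+2h}` into `K_m`); brings ★ `congruenceGL`, `ValBound`
import Literature.NumberTheory.Automorphic.AdelicHeightGLProofs                              -- ★ `GLn.one_le_localHeight`; brings ★ `GLn.localHeight`, `AdelicGroupData.adeleEval`
import Literature.NumberTheory.Automorphic.AddCharConductorExponent                          -- ★ `normAbs_eq_inv_zpow_of_valued_eq`, `normAbs_le_normAbs_iff_valued`, `inv_residueFieldCard_pos∕lt_one`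
import Literature.NumberTheory.Automorphic.AdicCompletionUniformizerResidueCardGlue          -- ★ `residueFieldCard_adicCompletion_eq_absNorm` (+ ★ `residueFieldCard_adicCompletion_eq`)
import Literature.NumberTheory.Automorphic.ValuedFieldValuativeRelBridge                     -- ★ `v_le_iff_valuation_le`, `isUniformizingElement_of_v_eq`
import HarnessLib

/-!
# Crux `HLiu418`, socket #41, (K1b-W) brick (KW1-c) sub-brick (c1) — `K2LiuLocalHeightLevelConjugation`: AN ADELIC POINT OF LOCAL HEIGHT `H_w(g) = q_w^a` CONJUGATES
# THE CONGRUENCE LEVEL `K_w(ϖ^{c+2a})` INTO `K_w(ϖ^c)`, AND RIGHT-INVARIANCE TRANSFERS TO TRANSLATED PULL-BACKS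

Cell `hodgecm-mathlib`, crux item hLiu418 = `stmt-HodgeConjecture-24832` (helper lane `--supports … --as helper`, count-neutral), route of record `HCCMUnconditional`;
squad K2 ∕ K2Liu (L1, LEAD F0P6-plan (g14) BATCH #79∕#82), road `K2_Liu`, socket #41, KIND 1, organ (K1b-W) (line lead K2Liu-p14 (g4)), brick (KW1-c)
`K2LiuKindOneLineWhittakerSupport` (the TOP's support letter `hsupp₁` at `n := 1` via ★ `K2LiuSiegelEisensteinKindWInstance.hsupp_of_local`), sub-brick (c1) of K2E3-p26 (g2)'s
sub-cut (K2 bus 2026-09-04T22:38:01Z, «=» LINE WORD #1 (3)).  Author K2E3-p26 (g2).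

THE POINT.  The per-place lattice letter `hloc` of ★ `hsupp_of_local` («`A i s x ≠ 0 ⇒ |mat i|_w ≤ q_w^m` with `q_w^m ≤ q_w^{δ_w}·H_w(ht x)^k`») is fed, at a place `w`, by
the vanishing of the local Whittaker integral of a TRANSLATED section `y ↦ f(ι y · g)` off the dual lattice of its right-invariance group (★ Φ5 F4a
`setIntegral_eq_zero_of_unipotent_translate`, ★ S-a `forall_addChar_eq_one_of_setIntegral_ne_zero`).  This file is the LEVEL-vs-HEIGHT dictionary that says how deep that
invariance group is in terms of the local height `H_w(g) = max_{ij}(|g_{ij}|_w, |g^{ij}|_w)` of ★ `GLn.localHeight` — the currency of `hloc`: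
* §1 `nnnorm_eq_normAbs`, `nnnorm_le_pow_iff_v_le` — Mathlib's norm on `L_w` against `Valued.v`: `‖x‖₊ ≤ q_w^a ⟺ |x|_w ≤ exp a` (★ `normAbs_eq_inv_zpow_of_valued_eq`);
  **`exists_localHeight_eq_pow`** — `H_w(g) = q_w^a` for some `a : ℕ` (`N ≥ 1`; a finite sup of norms in `q_w^ℤ`, `≥ 1` ★ `GLn.one_le_localHeight`), so that BOTH `H_w(g) ≤ q_w^a`
  (for the conjugation) and `q_w^a ≤ H_w(g)` (for the bound `q_w^m ≤ q_w^{δ}·H_w^k` of `hloc`) hold.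
* §2 `valBound_of_nnnorm_le` — entries of norm `≤ q_w^a` have `valuation ≤ (valuation ϖ_w ^ a)⁻¹` (★ bridge `v_le_iff_valuation_le`); **`conj_mem_congruenceGL_of_nnnorm_le`** (any
  `x ∈ GL_N(L_w)`) and **`conj_mem_congruenceGL_of_localHeight_le`** (`x = g_w = GeneralLinearGroup.map (adeleEval L w) g`) — `H_w(g) ≤ q_w^a`, `k ∈ K_w(ϖ_w^{c+2a})` ⇒ `g_w k g_w⁻¹, g_w⁻¹ k g_w ∈ K_w(ϖ_w^c)`
  (★ `conj_mem_congruenceGL_pow_of_height` ∕ `inv_conj_…`: `g k g⁻¹ − 1 = g(k − 1)g⁻¹` has entries `≤ q^a·q^{−(c+2a)}·q^a = q^{−c}`).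
* §3 **`apply_map_mul_mul_eq_of_forall_conj_mem`** — the abstract transfer: `F : G → Y` right-`K`-invariant, `ι : G₁ →* G`, and `g⁻¹·ι k₁·g ∈ K` for all `k₁ ∈ K₁′` ⇒
  `y ↦ F(ι y · g)` is right-`K₁′`-invariant (`ι(y k₁)·g = (ι y·g)·(g⁻¹ ι k₁ g)`); with §2 and the level clause `ι(K₁,w(m)) ⊆ K_w(m)` of the corner chart (p10's (e2), by value in
  (KW1-c)) this is «`f` right-`K_w(ϖ^c)`-invariant ⇒ `y ↦ f(ι y·g)` right-`K₁,w(ϖ^{c+2a})`-invariant, `q_w^a = H_w(g)`» of the (K1b-W) cut.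
[BorelJacquet1979, §1.2, §4.1]; [MoeglinWaldspurger1995, I.2.2]; [HarishChandra1999, §17 p. 80]; [Casselman1980, §3].

HONEST LABEL.  Count-neutral helper (pure dictionary); it retires nothing by itself: `HC_CM` is proved only modulo the 7 printed citations (2 remaining named inputs:
hLiu418 = `stmt-HodgeConjecture-24832`, h413 = `stmt-HodgeConjecture-24833`) until rung 0 closes.

## References
* [BorelJacquet1979] A. Borel, H. Jacquet, *Automorphic forms and automorphic representations*, Proc. Sympos. Pure Math. 33.1 (1979), §1.2 (heights), §4.1 (levels).
* [MoeglinWaldspurger1995] C. Mœglin, J.-L. Waldspurger, *Spectral decomposition and Eisenstein series*, Cambridge Tracts 113 (1995), I.2.2 (the height `‖g‖`).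
* [HarishChandra1999] Harish-Chandra (notes by DeBacker–Sally), *Admissible invariant distributions on reductive p-adic groups*, ULS 16 (1999), §17 p. 80 (conjugating levels).
* [Casselman1980] W. Casselman, *The unramified principal series of p-adic groups I*, Compositio Math. 40 (1980), §3 (lattice support of Whittaker functionals).
-/

set_option autoImplicit false
-- the mandated namespace repeats the single-problem summit's segment (`HodgeConjecture.HodgeConjecture`)
set_option linter.dupNamespace false

noncomputable section

open scoped NNReal MatrixGroups WithZero
open NumberField IsDedekindDomain Matrix ValuativeRel
open Literature.NumberTheory.Automorphic Literature.NumberTheory.GaloisRepresentations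
open Literature.NumberTheory.GaloisRepresentations.IsNonarchimedeanLocalField

namespace Summit.HodgeConjecture.HodgeConjecture.Cruxes.HLiu418.K2LiuLocalHeightLevelConjugation

open Summit.HodgeConjecture.HodgeConjecture.Cruxes.H413.K2E3CongruenceLayerIntertwiningGL

variable (L : Type) [Field L] [NumberField L] (w : HeightOneSpectrum (𝓞 L))

/-! ## §1 Mathlib's norm on `L_w` against `Valued.v`; the local height is a power of `q_w` -/

/-- `‖x‖₊ = normAbs x` on `L_w` (both are `q_w^{−ord_w x}`: Mathlib `FinitePlace.norm_def` and ★ `normAbs_eq_inv_zpow_of_valued_eq`; reproduced from ★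
`GlobalHeckeTheoryGL2OfCenterInvariant.norm_eq_coe_normAbs` to keep the import closure small). [cite: BorelJacquet1979, §1.2] -/
theorem nnnorm_eq_normAbs (x : w.adicCompletion L) : ‖x‖₊ = normAbs (w.adicCompletion L) x := by
  refine NNReal.eq ?_
  rw [coe_nnnorm]
  by_cases hx : x = 0
  · rw [hx, norm_zero, map_zero, NNReal.coe_zero]
  have hv : Valued.v x ≠ 0 := (Valuation.ne_zero_iff _).2 hx
  have hxn : Valued.v x = WithZero.exp (Multiplicative.toAdd (WithZero.unzero hv)) := by
    rw [WithZero.exp, ofAdd_toAdd, WithZero.coe_unzero]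
  rw [FinitePlace.norm_def, WithZeroMulInt.toNNReal_neg_apply _ hv,
    normAbs_eq_inv_zpow_of_valued_eq w hxn, residueFieldCard_adicCompletion_eq, _root_.inv_zpow', neg_neg]
  rfl

/-- `1 < q_w` in `ℝ≥0` (`q_w = N(𝔭_w)` ★ `residueFieldCard_adicCompletion_eq_absNorm`). [cite: BorelJacquet1979, §1.2] -/
theorem one_lt_absNorm_nnreal : (1 : ℝ≥0) < ((Ideal.absNorm w.asIdeal : ℕ) : ℝ≥0) := by
  rw [← residueFieldCard_adicCompletion_eq_absNorm L w]
  exact one_lt_residueFieldCard_nnreal (F := w.adicCompletion L)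

/-- **`‖x‖₊ = q_w^n` when `|x|_w = exp n`.** [cite: BorelJacquet1979, §1.2] -/
theorem nnnorm_eq_zpow_of_v_eq {x : w.adicCompletion L} {n : ℤ} (hx : Valued.v x = WithZero.exp n) :
    ‖x‖₊ = ((Ideal.absNorm w.asIdeal : ℕ) : ℝ≥0) ^ n := by
  rw [nnnorm_eq_normAbs, normAbs_eq_inv_zpow_of_valued_eq w hx, _root_.inv_zpow', neg_neg, residueFieldCard_adicCompletion_eq_absNorm L w]

/-- **`‖x‖₊ ≤ q_w^a ⟺ |x|_w ≤ exp a`** (`a : ℕ`). [cite: BorelJacquet1979, §1.2] -/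
theorem nnnorm_le_pow_iff_v_le (x : w.adicCompletion L) (a : ℕ) :
    ‖x‖₊ ≤ ((Ideal.absNorm w.asIdeal : ℕ) : ℝ≥0) ^ a ↔ Valued.v x ≤ WithZero.exp (a : ℤ) := by
  by_cases hx : x = 0
  · rw [hx, nnnorm_zero, map_zero]
    exact ⟨fun _ => bot_le, fun _ => bot_le⟩
  have hv : Valued.v x ≠ 0 := (Valuation.ne_zero_iff _).2 hx
  obtain ⟨n, hn⟩ : ∃ n : ℤ, Valued.v x = WithZero.exp n := ⟨_, (WithZero.exp_log hv).symm⟩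
  rw [nnnorm_eq_zpow_of_v_eq L w hn, hn, WithZero.exp_le_exp, ← zpow_natCast]
  exact zpow_le_zpow_iff_right₀ (one_lt_absNorm_nnreal L w)

variable {N : ℕ}

/-- The entries of `x` and of `x⁻¹` are bounded by the local height `H_w(g)` of `g ∈ GL_N(𝔸_L)`, `x = g_w` (★ `nnnorm_apply_le_sup`, `nnnorm_inv_apply_le_sup`).
[cite: BorelJacquet1979, §1.2] -/
theorem nnnorm_apply_le_localHeight (g : GL (Fin N) (AdeleRing (𝓞 L) L)) (i j : Fin N) :
    ‖(Matrix.GeneralLinearGroup.map (AdelicGroupData.adeleEval L w) g : Matrix (Fin N) (Fin N) (w.adicCompletion L)) i j‖₊ ≤ GLn.localHeight N L w g ∧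
      ‖(((Matrix.GeneralLinearGroup.map (AdelicGroupData.adeleEval L w) g)⁻¹ : GL (Fin N) (w.adicCompletion L)) : Matrix (Fin N) (Fin N) (w.adicCompletion L)) i j‖₊ ≤
        GLn.localHeight N L w g := by
  unfold GLn.localHeight
  exact ⟨nnnorm_apply_le_sup _ i j, nnnorm_inv_apply_le_sup _ i j⟩

/-- **THE LOCAL HEIGHT IS A POWER OF `q_w`**: `H_w(g) = q_w^a` for some `a : ℕ` (`N ≥ 1`) — `H_w(g)` is a finite supremum of norms `‖·‖₊ ∈ {0} ∪ q_w^ℤ` of entries of `g_w` and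
`g_w⁻¹`, attained at some entry, and `≥ 1` (★ `GLn.one_le_localHeight`). [cite: BorelJacquet1979, §1.2] [cite: MoeglinWaldspurger1995, I.2.2] -/
theorem exists_localHeight_eq_pow [NeZero N] (g : GL (Fin N) (AdeleRing (𝓞 L) L)) :
    ∃ a : ℕ, GLn.localHeight N L w g = ((Ideal.absNorm w.asIdeal : ℕ) : ℝ≥0) ^ a := by
  haveI : Nonempty (Fin N) := ⟨⟨0, Nat.pos_of_ne_zero (NeZero.ne N)⟩⟩
  have h1 := GLn.one_le_localHeight (n := N) (K := L) w g
  -- a norm `≥ 1` on `L_w` is `q_w^a`, `a : ℕ`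
  have key : ∀ x : w.adicCompletion L, 1 ≤ ‖x‖₊ → ∃ a : ℕ, ‖x‖₊ = ((Ideal.absNorm w.asIdeal : ℕ) : ℝ≥0) ^ a := by
    intro x hx1
    have hx : x ≠ 0 := fun h => by rw [h, nnnorm_zero] at hx1; exact not_lt.2 hx1 zero_lt_one
    have hv : Valued.v x ≠ 0 := (Valuation.ne_zero_iff _).2 hx
    obtain ⟨n, hn⟩ : ∃ n : ℤ, Valued.v x = WithZero.exp n := ⟨_, (WithZero.exp_log hv).symm⟩
    have hnorm := nnnorm_eq_zpow_of_v_eq L w hn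
    have hn0 : 0 ≤ n := by
      rw [hnorm, ← zpow_zero (((Ideal.absNorm w.asIdeal : ℕ) : ℝ≥0))] at hx1
      exact (zpow_le_zpow_iff_right₀ (one_lt_absNorm_nnreal L w)).1 hx1
    exact ⟨n.toNat, by rw [hnorm, ← zpow_natCast, Int.toNat_of_nonneg hn0]⟩
  -- the sup is attained at some entry of `g_w` or of `g_w⁻¹`
  obtain ⟨ij, -, hij⟩ := Finset.exists_mem_eq_sup (Finset.univ : Finset (Fin N × Fin N)) Finset.univ_nonempty
    (fun ij : Fin N × Fin N =>
      ‖(Matrix.GeneralLinearGroup.map (AdelicGroupData.adeleEval L w) g : Matrix (Fin N) (Fin N) (w.adicCompletion L)) ij.1 ij.2‖₊ ⊔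
        ‖(((Matrix.GeneralLinearGroup.map (AdelicGroupData.adeleEval L w) g)⁻¹ : GL (Fin N) (w.adicCompletion L)) :
          Matrix (Fin N) (Fin N) (w.adicCompletion L)) ij.1 ij.2‖₊)
  have hH : GLn.localHeight N L w g =
      ‖(Matrix.GeneralLinearGroup.map (AdelicGroupData.adeleEval L w) g : Matrix (Fin N) (Fin N) (w.adicCompletion L)) ij.1 ij.2‖₊ ⊔
        ‖(((Matrix.GeneralLinearGroup.map (AdelicGroupData.adeleEval L w) g)⁻¹ : GL (Fin N) (w.adicCompletion L)) :
          Matrix (Fin N) (Fin N) (w.adicCompletion L)) ij.1 ij.2‖₊ := by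
    unfold GLn.localHeight; exact hij
  rw [hH] at h1 ⊢
  rcases max_choice
      ‖(Matrix.GeneralLinearGroup.map (AdelicGroupData.adeleEval L w) g : Matrix (Fin N) (Fin N) (w.adicCompletion L)) ij.1 ij.2‖₊
      ‖(((Matrix.GeneralLinearGroup.map (AdelicGroupData.adeleEval L w) g)⁻¹ : GL (Fin N) (w.adicCompletion L)) :
        Matrix (Fin N) (Fin N) (w.adicCompletion L)) ij.1 ij.2‖₊ with hm | hm
  · rw [hm] at h1 ⊢; exact key _ h1
  · rw [hm] at h1 ⊢; exact key _ h1

/-! ## §2 Entries `≤ q_w^a` ⟹ `ValBound (valuation ϖ^a)⁻¹` ⟹ conjugation `K_w(ϖ^{c+2a}) → K_w(ϖ^c)` -/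

/-- **Entries of norm `≤ q_w^a` have `valuation ≤ (valuation ϖ_w ^ a)⁻¹`** (`ϖ_w` any uniformiser, `|ϖ_w|_w = exp(−1)`): `‖x_{ij}‖₊ ≤ q_w^a ⟺ |x_{ij}|_w ≤ exp a = |ϖ_w⁻ᵃ|_w`
(§1) `⟺ valuation x_{ij} ≤ valuation ϖ_w⁻ᵃ` (★ bridge `v_le_iff_valuation_le`) — the `ValBound` currency of ★ `congruenceGL`. [cite: BorelJacquet1979, §1.2] -/
theorem valBound_of_nnnorm_le (M : Matrix (Fin N) (Fin N) (w.adicCompletion L)) (a : ℕ)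
    (hM : ∀ i j, ‖M i j‖₊ ≤ ((Ideal.absNorm w.asIdeal : ℕ) : ℝ≥0) ^ a) {ϖ : w.adicCompletion L} (hϖ : Valued.v ϖ = WithZero.exp (-1 : ℤ)) :
    ValBound (valuation (w.adicCompletion L) ϖ ^ a)⁻¹ M := by
  have hϖa : Valued.v ((ϖ⁻¹) ^ a) = WithZero.exp (a : ℤ) := by
    rw [map_pow, map_inv₀, hϖ, ← WithZero.exp_neg, neg_neg, ← WithZero.exp_nsmul, nsmul_eq_mul, mul_one]
  have hval : valuation (w.adicCompletion L) ((ϖ⁻¹) ^ a) = (valuation (w.adicCompletion L) ϖ ^ a)⁻¹ := by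
    rw [map_pow, map_inv₀, inv_pow]
  intro i j
  rw [← hval, ← v_le_iff_valuation_le, hϖa]
  exact (nnnorm_le_pow_iff_v_le L w _ a).1 (hM i j)

/-- **ENTRIES OF `x` AND `x⁻¹` OF NORM `≤ q_w^a` ⟹ `x` CONJUGATES `K_w(ϖ^{c+2a})` INTO `K_w(ϖ^c)`** (both ways), for `x ∈ GL_N(L_w)`: `x k x⁻¹ − 1 = x(k − 1)x⁻¹` has entries
`≤ q^a·q^{−(c+2a)}·q^a = q^{−c}` (★ `conj_mem_congruenceGL_pow_of_height` ∕ `inv_conj_mem_congruenceGL_pow_of_height`, fed by `valBound_of_nnnorm_le`).  So a RIGHT TRANSLATE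
by `x` of a right-`K_w(ϖ^c)`-invariant function is right-`K_w(ϖ^{c+2a})`-invariant (§3). [cite: HarishChandra1999, §17 p. 80] [cite: BorelJacquet1979, §4.1] -/
theorem conj_mem_congruenceGL_of_nnnorm_le (x : GL (Fin N) (w.adicCompletion L)) (c a : ℕ)
    (hx : ∀ i j, ‖(x : Matrix (Fin N) (Fin N) (w.adicCompletion L)) i j‖₊ ≤ ((Ideal.absNorm w.asIdeal : ℕ) : ℝ≥0) ^ a)
    (hx' : ∀ i j, ‖((x⁻¹ : GL (Fin N) (w.adicCompletion L)) : Matrix (Fin N) (Fin N) (w.adicCompletion L)) i j‖₊ ≤ ((Ideal.absNorm w.asIdeal : ℕ) : ℝ≥0) ^ a)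
    {ϖ : w.adicCompletion L} (hϖ : Valued.v ϖ = WithZero.exp (-1 : ℤ))
    {k : GL (Fin N) (w.adicCompletion L)} (hk : k ∈ congruenceGL N (valuation (w.adicCompletion L) ϖ ^ (c + 2 * a))) :
    x * k * x⁻¹ ∈ congruenceGL N (valuation (w.adicCompletion L) ϖ ^ c) ∧ x⁻¹ * k * x ∈ congruenceGL N (valuation (w.adicCompletion L) ϖ ^ c) := by
  have hu : IsUniformizingElement ϖ := isUniformizingElement_of_v_eq hϖ
  have h1 := valBound_of_nnnorm_le L w _ a hx hϖ
  have h2 := valBound_of_nnnorm_le L w _ a hx' hϖ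
  exact ⟨conj_mem_congruenceGL_pow_of_height hu c a h1 h2 hk, inv_conj_mem_congruenceGL_pow_of_height hu c a h1 h2 hk⟩

/-- **AN ADELIC POINT OF LOCAL HEIGHT `≤ q_w^a` CONJUGATES `K_w(ϖ^{c+2a})` INTO `K_w(ϖ^c)`** (both ways): `H_w(g) ≤ q_w^a`, `k ∈ K_w(ϖ_w^{c+2a})` ⇒
`g_w k g_w⁻¹ ∈ K_w(ϖ_w^c)` and `g_w⁻¹ k g_w ∈ K_w(ϖ_w^c)`, `g_w = GeneralLinearGroup.map (adeleEval L w) g` (`nnnorm_apply_le_localHeight` + `conj_mem_congruenceGL_of_nnnorm_le`).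
With §1 `exists_localHeight_eq_pow` one takes `q_w^a = H_w(g)` exactly, so that the `hloc` bound `q_w^m ≤ q_w^{δ}·H_w(g)^k` reads `q_w^{c+2a} = q_w^c·(q_w^a)^2`.
[cite: HarishChandra1999, §17 p. 80] [cite: BorelJacquet1979, §1.2, §4.1] -/
theorem conj_mem_congruenceGL_of_localHeight_le (g : GL (Fin N) (AdeleRing (𝓞 L) L)) (c a : ℕ)
    (hH : GLn.localHeight N L w g ≤ ((Ideal.absNorm w.asIdeal : ℕ) : ℝ≥0) ^ a) {ϖ : w.adicCompletion L} (hϖ : Valued.v ϖ = WithZero.exp (-1 : ℤ))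
    {k : GL (Fin N) (w.adicCompletion L)} (hk : k ∈ congruenceGL N (valuation (w.adicCompletion L) ϖ ^ (c + 2 * a))) :
    Matrix.GeneralLinearGroup.map (AdelicGroupData.adeleEval L w) g * k * (Matrix.GeneralLinearGroup.map (AdelicGroupData.adeleEval L w) g)⁻¹ ∈
        congruenceGL N (valuation (w.adicCompletion L) ϖ ^ c) ∧
      (Matrix.GeneralLinearGroup.map (AdelicGroupData.adeleEval L w) g)⁻¹ * k * Matrix.GeneralLinearGroup.map (AdelicGroupData.adeleEval L w) g ∈
        congruenceGL N (valuation (w.adicCompletion L) ϖ ^ c) :=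
  conj_mem_congruenceGL_of_nnnorm_le L w _ c a (fun i j => (nnnorm_apply_le_localHeight L w g i j).1.trans hH)
    (fun i j => (nnnorm_apply_le_localHeight L w g i j).2.trans hH) hϖ hk

/-! ## §3 Right-invariance transfers to translated pull-backs along a group morphism -/

/-- **RIGHT-INVARIANCE OF A TRANSLATED PULL-BACK**: if `F : G → Y` is right-`K`-invariant, `ι : G₁ →* G`, `g ∈ G`, and `g⁻¹·ι k₁·g ∈ K` for every `k₁ ∈ K₁′`, then
`y ↦ F(ι y · g)` is right-`K₁′`-invariant — `ι(y k₁)·g = (ι y·g)·(g⁻¹·ι k₁·g)`.  With §2 (`K := K_w(ϖ^c)`, `K₁′ := ι⁻¹`-level `ϖ^{c+2a}`, `g := g_w`) this is the (K1b-W) letter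
«`f` right-`K_w(ϖ^c)`-invariant ⇒ `y ↦ f(ι y·g_w)` right-`K₁,w(ϖ^{c+2a})`-invariant, `q_w^a = H_w(g)`» for the corner chart `ι = blkD(1,·)` (whose level clause `ι(K₁,w(m)) ⊆ K_w(m)` is the
consumer's by-value letter). [cite: Casselman1980, §3] [cite: BorelJacquet1979, §4.1] -/
theorem apply_map_mul_mul_eq_of_forall_conj_mem {G₁ G : Type*} [Group G₁] [Group G] {Y : Sort*} (F : G → Y) (K : Subgroup G)
    (hF : ∀ (x : G) (k : G), k ∈ K → F (x * k) = F x) (ι : G₁ →* G) (g : G) (K₁ : Subgroup G₁)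
    (hK₁ : ∀ k₁ ∈ K₁, g⁻¹ * ι k₁ * g ∈ K) (y k₁ : G₁) (hk₁ : k₁ ∈ K₁) :
    F (ι (y * k₁) * g) = F (ι y * g) := by
  have h : ι (y * k₁) * g = ι y * g * (g⁻¹ * ι k₁ * g) := by rw [map_mul]; group
  rw [h]
  exact hF _ _ (hK₁ k₁ hk₁)

/-- The same with the conjugate written `g⁻¹ k g` for `k = ι k₁` ranging over the IMAGE level: if `F` is right-`K`-invariant and `g⁻¹ k g ∈ K` for all `k ∈ K′ ≤ G`, then
`x ↦ F(x · g)` is right-`K′`-invariant (`ι = id`). [cite: Casselman1980, §3] -/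
theorem apply_mul_mul_eq_of_forall_conj_mem {G : Type*} [Group G] {Y : Sort*} (F : G → Y) (K : Subgroup G)
    (hF : ∀ (x : G) (k : G), k ∈ K → F (x * k) = F x) (g : G) (K' : Subgroup G) (hK' : ∀ k ∈ K', g⁻¹ * k * g ∈ K) (x k : G) (hk : k ∈ K') :
    F (x * k * g) = F (x * g) :=
  apply_map_mul_mul_eq_of_forall_conj_mem F K hF (MonoidHom.id G) g K' hK' x k hk

end Summit.HodgeConjecture.HodgeConjecture.Cruxes.HLiu418.K2LiuLocalHeightLevelConjugation

end
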